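import Literature.NumberTheory.LFunctions.WeilMarkovQuadratic
import Literature.NumberTheory.LFunctions.RiemannSiegel
import Mathlib.Analysis.Distribution.SchwartzSpace.Deriv
import Mathlib.Analysis.Fourier.FourierTransform
import Mathlib.Analysis.Calculus.BumpFunction.Basic

/-!
# RiemannHypothesis / SpectralTrace — definitions posited by line `floor-feedback` of the crux `WindowStep`

Route `RiemannHypothesis/SpectralTrace`, crux item `WindowStep` (stmt-RiemannHypothesis-14659), line `floor-feedback`
(checked skeleton `Cruxes/WindowStep/Lines/floor_feedback.lean`; line card `Cruxes/WindowStep/Lines/floor-feedback.md`,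
definition request D1). This file collects the DEFINITIONS the line posits, verbatim from the checked skeleton (only the
namespace differs), so that the stub proofs landing under `Theorems/` (`--supports stmt-RiemannHypothesis-14659`) import
them instead of restating them:

* `WTrace A` — `Trace(A)`: some real family reproduces `W` on the Weil tests supported in `[-A, A]`;
* `IsWindowDensity A ρ` — a real density on the critical line realising `W` on the window;
* `IsFeedbackKernel A k` — a real Schwartz kernel with Fourier transform `≡ 1` on the band `|w| ≤ A/2π`;
* `IsFloorFeedback Φ h k` — the floor–feedback (noise-shaping) equation `h = k ⋆ fract(Φ + h)`, `h` continuous;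
* `DensityFloor ρ T₀ C`, `slopeBudget k = ‖k′‖₁`, `handover T₀ C k = max T₀ (exp (2πC + π‖k′‖₁))`;
* the explicit model of the window `[-A, A]`: `windowCutoff`, `polarKernel`, `primeMass`, `modelDensity`
  (`ρ_A = θ′/π + p_A − (1/π) Σ_{log m < A} Λ(m) m^{-1/2} cos(T log m)`), `modelCount` (`Φ_A = ∫₀ᵀ ρ_A`),
  `floorConst`, `floorHeight`, `quietHeight`;
* `QuietRung A` — the line's RH-strength(-or-false) object: a floor–feedback solution over `Φ_A` with an admissible
  kernel whose integer count `⌊Φ_A + h⌋` is monotone below the handover height.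

The only theorems are small sanity lemmas about the constants (`handover_pos`, `le_handover`, `exp_le_handover`,
`slopeBudget_nonneg`, `quietHeight_pos`) and the registered sanity stub `stub_defs`. Normalisations are those of `Literature.NumberTheory.LFunctions.WeilExplicit`
(`weilMellin g (1/2 + iT) = ∫ g(t) e^{iTt} dt`, `weilFunctional = polar − prime + arch`) and of Mathlib's real Fourier
transform `𝓕 f (w) = ∫ f(v) e^{-2πivw} dv`. References: I. Daubechies, R. DeVore, Ann. of Math. 158 (2003) 679–710
(noise shaping) [DaubechiesDeVore2003]; the line card for the mechanism. Nothing here asserts any stub.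
-/

noncomputable section

open Complex Filter Set MeasureTheory
open scoped Real Topology BigOperators FourierTransform SchwartzMap

set_option linter.dupNamespace false

namespace Summit.RiemannHypothesis.RiemannHypothesis.Theorems.FloorFeedback

open Literature.NumberTheory.LFunctions

/-! ## The vocabulary of the line -/

/-- `Trace(A)`: some real family reproduces `W` on the Weil tests supported in `[-A, A]` (the common shape of
`WindowTraceArch = WTrace (log 2)`, `WindowTracePrime2 = WTrace (log 3)` and of both sides of `WindowStep`).
[folklore] -/
def WTrace (A : ℝ) : Prop :=
  ∃ (ι : Type) (γ : ι → ℝ), ∀ g : ℝ → ℂ, IsWeilTest g → tsupport g ⊆ Icc (-A) A →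
    HasSum (fun i => weilMellin g (1 / 2 + (γ i : ℂ) * I)) (weilFunctional g)

/-- A WINDOW DENSITY at level `A`: a real density on the critical line realising `W` on the window,
`∫ ĝ(1/2 + iT) ρ(T) dT = W(g)` (with integrability) for every Weil test `g` supported in `[-A, A]`. [folklore] -/
def IsWindowDensity (A : ℝ) (ρ : ℝ → ℝ) : Prop :=
  ∀ g : ℝ → ℂ, IsWeilTest g → tsupport g ⊆ Icc (-A) A →
    Integrable (fun T : ℝ => weilMellin g (1 / 2 + (T : ℂ) * I) * ((ρ T : ℝ) : ℂ)) ∧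
    ∫ T : ℝ, weilMellin g (1 / 2 + (T : ℂ) * I) * ((ρ T : ℝ) : ℂ) = weilFunctional g

/-- An admissible FEEDBACK KERNEL for the window `A`: a real Schwartz function whose Fourier transform (Mathlib
normalisation `𝓕 f(w) = ∫ f(v) e^{-2πivw} dv`) is `≡ 1` on the closed band `|w| ≤ A/2π` — the band carrying the line
transforms `T ↦ ĝ(1/2 + iT)` of the tests supported in `[-A, A]` (`𝓕[ĝ(1/2 + i·)](w) = 2π g(2πw)`). [folklore] -/
def IsFeedbackKernel (A : ℝ) (k : 𝓢(ℝ, ℝ)) : Prop :=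
  ∀ w : ℝ, |w| ≤ A / (2 * π) → 𝓕 (fun T : ℝ => ((k T : ℝ) : ℂ)) w = 1

/-- The FLOOR–FEEDBACK (noise-shaping) equation: `h` is continuous and `h = k ⋆ fract(Φ + h)` pointwise
(a Bochner integral; the integrand is integrable since `k` is Schwartz and `fract ∈ [0, 1)`). [folklore] -/
def IsFloorFeedback (Φ h : ℝ → ℝ) (k : 𝓢(ℝ, ℝ)) : Prop :=
  Continuous h ∧ ∀ T : ℝ, h T = ∫ s : ℝ, k (T - s) * Int.fract (Φ s + h s)

/-- A DENSITY FLOOR from height `T₀` on: `ρ(T) ≥ (1/2π) log|T| − C` for `|T| ≥ T₀`. [folklore] -/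
def DensityFloor (ρ : ℝ → ℝ) (T₀ C : ℝ) : Prop :=
  ∀ T : ℝ, T₀ ≤ |T| → Real.log |T| / (2 * π) - C ≤ ρ T

/-- The Bernstein budget `‖k′‖₁ = ∫ |k′|` of a kernel (`|h′| ≤ ‖k′‖₁/2` for every floor–feedback solution).
[folklore] -/
def slopeBudget (k : 𝓢(ℝ, ℝ)) : ℝ :=
  ∫ T : ℝ, |deriv (fun x : ℝ => k x) T|

/-- The HANDOVER HEIGHT above which monotonicity of `Φ + h` is automatic:
`max(T₀, exp(2πC + π‖k′‖₁))` (`(1/2π) log|T| − C − ‖k′‖₁/2 ≥ 0` there). [folklore] -/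
def handover (T₀ C : ℝ) (k : 𝓢(ℝ, ℝ)) : ℝ :=
  max T₀ (Real.exp (2 * π * C + π * slopeBudget k))

/-! ## The explicit model count of the window `[-A, A]` -/

/-- Smooth even cutoff `≡ 1` on `[-(|A|+1), |A|+1]`, supported in `(-(|A|+2), |A|+2)`. [folklore] -/
def windowCutoff (A : ℝ) : ContDiffBump (0 : ℝ) :=
  ⟨|A| + 1, |A| + 2, by positivity, by linarith [abs_nonneg A]⟩

/-- The POLAR KERNEL `p_A(T) = (1/2π) ∫ 2cosh(t/2) χ_A(t) cos(tT) dt`: the real, even, rapidly decaying density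
representing the polar term on the window, `∫ ĝ(1/2+iT) p_A(T) dT = ĝ(0) + ĝ(1)` for tests supported in `[-A, A]`.
[folklore] -/
def polarKernel (A T : ℝ) : ℝ :=
  1 / (2 * π) * ∫ t : ℝ, 2 * Real.cosh (t / 2) * windowCutoff A t * Real.cos (t * T)

/-- `M(A) = Σ_{log m < A} Λ(m)/√m`, the total spike mass visible on the window (`weilPrimeIndex (A/2) = {m : log m < A}`).
[folklore] -/
def primeMass (A : ℝ) : ℝ :=
  ∑ m ∈ weilPrimeIndex (A / 2), (ArithmeticFunction.vonMangoldt m : ℝ) / Real.sqrt m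

/-- The explicit WINDOW DENSITY `ρ_A(T) = θ′(T)/π + p_A(T) − (1/π) Σ_{log m < A} Λ(m) m^{-1/2} cos(T log m)`
(`θ′ = riemannSiegelThetaDeriv = Re ψ(1/4 + iT/2)/2 − (log π)/2`). [folklore] -/
def modelDensity (A T : ℝ) : ℝ :=
  riemannSiegelThetaDeriv T / π + polarKernel A T -
    1 / π * ∑ m ∈ weilPrimeIndex (A / 2),
      (ArithmeticFunction.vonMangoldt m : ℝ) / Real.sqrt m * Real.cos (T * Real.log m)

/-- The explicit MODEL COUNT `Φ_A(T) = ∫₀ᵀ ρ_A`. [folklore] -/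
def modelCount (A T : ℝ) : ℝ :=
  ∫ s in (0 : ℝ)..T, modelDensity A s

/-- The explicit floor constant `C⋆(A) = log(2π)/(2π) + M(A)/π + 1/10`. [folklore] -/
def floorConst (A : ℝ) : ℝ :=
  Real.log (2 * π) / (2 * π) + primeMass A / π + 1 / 10

/-- The least height `≥ 1` from which the floor `ρ_A ≥ (1/2π) log|T| − C⋆(A)` holds (an `sInf`; the defining set is a
non-empty closed ray, part of the line's stub K0). [folklore] -/
def floorHeight (A : ℝ) : ℝ :=
  sInf {T₀ : ℝ | 1 ≤ T₀ ∧ DensityFloor (modelDensity A) T₀ (floorConst A)}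

/-- The handover height of the window `A` and the kernel `k`: `T₁(A, k) = handover (floorHeight A) (floorConst A) k`.
[folklore] -/
def quietHeight (A : ℝ) (k : 𝓢(ℝ, ℝ)) : ℝ :=
  handover (floorHeight A) (floorConst A) k

/-- **A QUIET RUNG at level `A`** — the RH-strength(-or-false) object of the line: a floor–feedback solution
`h = k ⋆ fract(Φ_A + h)` over the explicit model count `Φ_A`, with an admissible kernel, whose integer count
`⌊Φ_A + h⌋` has no downward crossing on `[-T₁, T₁]`, `T₁ = quietHeight A k`. [folklore] -/
def QuietRung (A : ℝ) : Prop :=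
  ∃ (h : ℝ → ℝ) (k : 𝓢(ℝ, ℝ)), IsFeedbackKernel A k ∧ IsFloorFeedback (modelCount A) h k ∧
    MonotoneOn (fun T : ℝ => ⌊modelCount A T + h T⌋) (Icc (-quietHeight A k) (quietHeight A k))

/-! ## Sanity lemmas about the constants -/

/-- `‖k′‖₁ ≥ 0`. [folklore] -/
theorem slopeBudget_nonneg (k : 𝓢(ℝ, ℝ)) : 0 ≤ slopeBudget k :=
  integral_nonneg fun _ => abs_nonneg _

/-- The handover height is positive. [folklore] -/
theorem handover_pos (T₀ C : ℝ) (k : 𝓢(ℝ, ℝ)) : 0 < handover T₀ C k :=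
  lt_of_lt_of_le (Real.exp_pos _) (le_max_right _ _)

/-- `T₀ ≤ handover T₀ C k`. [folklore] -/
theorem le_handover (T₀ C : ℝ) (k : 𝓢(ℝ, ℝ)) : T₀ ≤ handover T₀ C k :=
  le_max_left _ _

/-- `exp (2πC + π‖k′‖₁) ≤ handover T₀ C k`. [folklore] -/
theorem exp_le_handover (T₀ C : ℝ) (k : 𝓢(ℝ, ℝ)) :
    Real.exp (2 * π * C + π * slopeBudget k) ≤ handover T₀ C k :=
  le_max_right _ _

/-- The handover height of a window is positive. [folklore] -/
theorem quietHeight_pos (A : ℝ) (k : 𝓢(ℝ, ℝ)) : 0 < quietHeight A k :=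
  handover_pos _ _ _

/-- Registered sanity stub `stub_defs` of the crux item (the theorem that travels with this definitions file):
the handover height of every window and kernel is positive. [folklore] -/
theorem stub_defs : ∀ (A : ℝ) (k : 𝓢(ℝ, ℝ)), 0 < quietHeight A k := fun A k => quietHeight_pos A k

end Summit.RiemannHypothesis.RiemannHypothesis.Theorems.FloorFeedback

end
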